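import Mathlib.LinearAlgebra.FreeModule.PID
import Mathlib.LinearAlgebra.StdBasis
import Mathlib.GroupTheory.Index
import Mathlib.GroupTheory.OrderOfElement
import Mathlib.GroupTheory.QuotientGroup.Basic
import Mathlib.Algebra.BigOperators.Field
import Mathlib.Data.Real.Basic
import Mathlib.Algebra.EuclideanDomain.Int
import Mathlib.RingTheory.PrincipalIdealDomain
import Mathlib.Tactic.FieldSimp
import Mathlib.Tactic.Linarith
import Mathlib.Tactic.Ring
import HarnessLib

/-!
# Lifting a distance homomorphism of a relation lattice to a linear form

Topic `Literature/NumberTheory/CubicFields` (the linear-algebra step of the class-group stage of Hallgren's algorithm,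
Hallgren 2005, §4; Buchmann–Williams 1988, §3): for a finite-index lattice `Λ ≤ ℤ^T` (the relation lattice of the generator
classes of an ideal class group) and a function `f` on `ℤ^T` that is ADDITIVE MODULO `R` on `Λ` (the logarithmic distance of
the principal generator of `∏ 𝔤_t^{v_t}`, defined modulo the regulator), there is a real vector `λ` with
`f v ≡ Σ_t λ_t v_t (mod R)` for every `v ∈ Λ`:

* `addHom_eq_of_basis` — two additive maps from a free `ℤ`-module agreeing on a basis coincide;
* `exists_linear_lift_mod` — **the lift**: choose a `ℤ`-basis of `Λ`, let `g` be the `ℤ`-linear map with `g = f` on the basis;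
  then `g ≡ f (mod R)` on `Λ`, and `g v = Σ_t λ_t v_t` with `λ_t = g ([ℤ^T : Λ] e_t) / [ℤ^T : Λ]`.

Theorem-only file, Mathlib only.

## References

* S. Hallgren, *Fast quantum algorithms for computing the unit group and class group of a number field*, STOC 2005, §4.
* J. Buchmann, H. C. Williams, Math. Comp. 50 (1988), §3. [BuchmannWilliams1988Infrastructure]
-/

namespace Literature.NumberTheory.CubicFields

open Module

section Lift

/-- Two additive homomorphisms from a `ℤ`-module with a basis that agree on the basis are equal. [folklore] -/
theorem addHom_eq_of_basis {M A : Type*} [AddCommGroup M] [AddCommGroup A] {ι : Type*} (b : Basis ι ℤ M)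
    {φ ψ : M →+ A} (h : ∀ i, φ (b i) = ψ (b i)) : φ = ψ := by
  have h' : φ.toIntLinearMap = ψ.toIntLinearMap := b.ext fun i => h i
  ext x
  exact LinearMap.congr_fun h' x

/-- **Lifting a map additive modulo `R` on a finite-index lattice to a linear form.** If `Λ ≤ ℤ^T` has finite index and
`f (v + w) − f v − f w ∈ Rℤ` for all `v, w ∈ Λ`, then there is `λ : Fin T → ℝ` with `f v − Σ_t λ_t v_t ∈ Rℤ` for all
`v ∈ Λ`. [cite: BuchmannWilliams1988Infrastructure, §3] -/
theorem exists_linear_lift_mod {T : ℕ} (Λ : AddSubgroup (Fin T → ℤ)) [Λ.FiniteIndex] (R : ℝ) (f : (Fin T → ℤ) → ℝ)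
    (hf : ∀ v ∈ Λ, ∀ w ∈ Λ, ∃ z : ℤ, f (v + w) - f v - f w = z * R) :
    ∃ lam : Fin T → ℝ, ∀ v ∈ Λ, ∃ z : ℤ, f v - ∑ t, lam t * v t = z * R := by
  classical
  set M : Submodule ℤ (Fin T → ℤ) := Λ.toIntSubmodule with hM
  have hmemM : ∀ v, v ∈ M ↔ v ∈ Λ := fun v => Iff.rfl
  obtain ⟨n, bM⟩ := Submodule.basisOfPid (Pi.basisFun ℤ (Fin T)) M
  -- the linear map agreeing with `f` on the basis
  set g : M →ₗ[ℤ] ℝ := bM.constr ℤ fun i => f (bM i) with hg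
  have hgb : ∀ i, g (bM i) = f (bM i) := fun i => by rw [hg, Basis.constr_basis]
  -- `g ≡ f (mod R)` on `M`: compare the two induced homomorphisms to `ℝ ⧸ Rℤ`
  set Z : AddSubgroup ℝ := AddSubgroup.zmultiples R with hZ
  set F : M →+ ℝ ⧸ Z :=
    { toFun := fun v => ((f v : ℝ) : ℝ ⧸ Z)
      map_zero' := by
        obtain ⟨z, hz⟩ := hf 0 Λ.zero_mem 0 Λ.zero_mem
        rw [add_zero] at hz
        have h0 : f 0 = -(z * R) := by linarith
        rw [Submodule.coe_zero, h0, QuotientAddGroup.eq_zero_iff, neg_mem_iff, hZ, AddSubgroup.mem_zmultiples_iff]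
        exact ⟨z, by simp⟩
      map_add' := by
        intro v w
        obtain ⟨z, hz⟩ := hf v v.2 w w.2
        rw [Submodule.coe_add, ← QuotientAddGroup.mk_add, QuotientAddGroup.eq_iff_sub_mem, hZ,
          AddSubgroup.mem_zmultiples_iff]
        exact ⟨z, by rw [show f (↑v + ↑w) - (f ↑v + f ↑w) = z * R by linarith]; simp⟩ } with hF
  set Gq : M →+ ℝ ⧸ Z := (QuotientAddGroup.mk' Z).comp g.toAddMonoidHom with hGq
  have hFG : F = Gq := addHom_eq_of_basis bM fun i => by
    simp only [hF, hGq, AddMonoidHom.coe_comp, Function.comp_apply, QuotientAddGroup.coe_mk',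
      LinearMap.toAddMonoidHom_coe, AddMonoidHom.coe_mk, ZeroHom.coe_mk, hgb]
  have hmod : ∀ v : M, ∃ z : ℤ, f v - g v = z * R := by
    intro v
    have h := congrArg (fun φ : M →+ ℝ ⧸ Z => φ v) hFG
    simp only [hF, hGq, AddMonoidHom.coe_comp, Function.comp_apply, QuotientAddGroup.coe_mk',
      LinearMap.toAddMonoidHom_coe, AddMonoidHom.coe_mk, ZeroHom.coe_mk] at h
    rw [QuotientAddGroup.eq_iff_sub_mem, hZ, AddSubgroup.mem_zmultiples_iff] at h
    obtain ⟨z, hz⟩ := h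
    exact ⟨z, by rw [← hz]; simp⟩
  -- the linear form: `λ_t = g (N e_t) / N`
  set Nn : ℕ := Λ.index with hNn
  have hN0 : Nn ≠ 0 := AddSubgroup.FiniteIndex.index_ne_zero
  have hNR : (Nn : ℝ) ≠ 0 := by exact_mod_cast hN0
  have hbasis : ∀ t : Fin T, (Nn • (Pi.basisFun ℤ (Fin T) t) : Fin T → ℤ) ∈ M := fun t =>
    (hmemM _).2 (AddSubgroup.nsmul_index_mem Λ _)
  set lam : Fin T → ℝ := fun t => g ⟨_, hbasis t⟩ / Nn with hlam
  refine ⟨lam, fun v hv => ?_⟩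
  obtain ⟨z, hz⟩ := hmod ⟨v, (hmemM v).2 hv⟩
  refine ⟨z, ?_⟩
  rw [← hz]
  congr 1
  -- `g v = Σ λ_t v_t`: compare `N • g v` with `g (N • v) = Σ v_t g (N e_t)`
  have hNv : (Nn : ℤ) • (⟨v, (hmemM v).2 hv⟩ : M) = ∑ t, v t • (⟨_, hbasis t⟩ : M) := by
    apply Subtype.ext
    simp only [SetLike.val_smul, Submodule.coe_sum]
    conv_lhs => rw [pi_eq_sum_univ v]
    rw [Finset.smul_sum]
    refine Finset.sum_congr rfl fun t _ => ?_
    ext j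
    simp only [Pi.smul_apply, Pi.basisFun_apply, smul_eq_mul, nsmul_eq_mul, Pi.mul_apply, Pi.natCast_apply,
      Pi.single_apply]
    split_ifs with h1 h2 h2
    · ring
    · exact absurd h1.symm h2
    · exact absurd h2.symm h1
    · ring
  have h1 : g ((Nn : ℤ) • (⟨v, (hmemM v).2 hv⟩ : M)) = (Nn : ℝ) * g ⟨v, (hmemM v).2 hv⟩ := by
    rw [map_zsmul, zsmul_eq_mul]; push_cast; ring
  have h2 : g (∑ t, v t • (⟨_, hbasis t⟩ : M)) = ∑ t, (v t : ℝ) * g ⟨_, hbasis t⟩ := by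
    rw [map_sum]
    refine Finset.sum_congr rfl fun t _ => ?_
    rw [map_zsmul, zsmul_eq_mul]
  rw [hNv, h2] at h1
  have h3 : ∑ t, lam t * (v t : ℝ) = (∑ t, (v t : ℝ) * g ⟨_, hbasis t⟩) / Nn := by
    rw [hlam, Finset.sum_div]
    refine Finset.sum_congr rfl fun t _ => ?_
    ring
  rw [h3, h1]
  field_simp

end Lift

section Summary

/-- **Summary (registered helper of the class-group stage)**: lifting a map additive modulo `R` on a finite-index lattice
of `ℤ^T` to a real linear form. [cite: BuchmannWilliams1988Infrastructure, §3] -/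
theorem relationLattice_exists_linear_lift_mod : ∀ (T : ℕ) (Λ : AddSubgroup (Fin T → ℤ)) [Λ.FiniteIndex] (R : ℝ) (f : (Fin T → ℤ) → ℝ), (∀ v ∈ Λ, ∀ w ∈ Λ, ∃ z : ℤ, f (v + w) - f v - f w = z * R) → ∃ lam : Fin T → ℝ, ∀ v ∈ Λ, ∃ z : ℤ, f v - ∑ t, lam t * v t = z * R :=
  fun _ Λ _ R f hf => exists_linear_lift_mod Λ R f hf

end Summary

end Literature.NumberTheory.CubicFields
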